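import Mathlib
import Summits.Ventures.PercRepro2.Defs
import Summits.Ventures.PercRepro2.Independence
import Summits.Ventures.PercRepro2.Harris
import Summits.Ventures.PercRepro2.Graph
import Summits.Ventures.PercRepro2.Exploration
import Summits.Ventures.PercRepro2.Induced
import Summits.Ventures.PercRepro2.ObsIndependence
import Summits.Ventures.PercRepro2.BHKEvents

/-!
# Merged clusters of the union event (blind cell PercRepro2, mine-1 g34) — definitions and the
spatial Markov lemmas

Row 2′CON-U conditions the pair law `λ̄ = Law(C_s, C_t | s ↮ t)` on the union event
`U = {s ↮ X} ∪ {t ↮ Y}`.  Reading the union as a non-connection in the mixed graph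
`G + (X → z → Y)` (a ghost vertex `z` with directed edges of weight `1`) identifies the natural
pair of clusters of the conditioned law: the *merged clusters*

* `S* = merged ends ω s X Y = C_s ∪ (C_Y if s ↔ X)` — the forward cluster of `s` in the ghost graph,
* `T* = merged ends ω t Y X = C_t ∪ (C_X if t ↔ Y)` — the backward cluster of `t`,

with `{s ↛ t in the ghost graph} = {t ∉ S*} = {s ∉ T*} = {s ↮ t} ∩ U`.

This file: the definition, monotonicity, the closed-off property (a merged cluster is a union of
open clusters, so every edge leaving it is closed), the domain Markov property of its level sets
(`dependsOn_mergedEvent`), and the spatial Markov identity `merged_delConfig_merged`: on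
`{t ∉ S*}` the merged cluster of `t` is its merged cluster in `G ∖ S*`.  The tower identity
`expect_merged_mul_indicator` is the finite-sum form of "explore `S*`; the rest is fresh".
The positive association of `(S*, T*)` under `λ̄(· | U)` is proved in `MergedUnionChain.lean` /
`MergedUnionPA.lean` by the Gibbs-chain method of BHK06 §2 (no four-function induction).
-/

namespace Summit.Ventures.PercRepro2

namespace MergedU

section Defs

variable {V : Type*} {E : Type*} {ends : E → Sym2 V}

/-- The **merged cluster** of `s` for the ordered pair of vertex sets `(X, Y)`: the open cluster
of `s`, together with the open clusters of all vertices of `Y` when `s` is connected to `X`. -/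
def merged (ends : E → Sym2 V) (ω : Config E) (s : V) (X Y : Set V) : Set V :=
  cluster ends ω s ∪ {v | (∃ x ∈ X, Conn ends ω s x) ∧ ∃ y ∈ Y, Conn ends ω y v}

/-- Membership in the merged cluster. -/
lemma mem_merged {ω : Config E} {s : V} {X Y : Set V} {v : V} :
    v ∈ merged ends ω s X Y ↔
      Conn ends ω s v ∨ ((∃ x ∈ X, Conn ends ω s x) ∧ ∃ y ∈ Y, Conn ends ω y v) := Iff.rfl

/-- The cluster of `s` is contained in its merged cluster. -/
lemma cluster_subset_merged (ω : Config E) (s : V) (X Y : Set V) :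
    cluster ends ω s ⊆ merged ends ω s X Y :=
  Set.subset_union_left

/-- `s` lies in its merged cluster. -/
lemma mem_merged_self (ω : Config E) (s : V) (X Y : Set V) : s ∈ merged ends ω s X Y :=
  cluster_subset_merged ω s X Y (mem_cluster_self ends ω s)

/-- The merged cluster is monotone in the configuration. -/
lemma merged_mono {ω ω' : Config E} (h : ω ≤ ω') (s : V) (X Y : Set V) :
    merged ends ω s X Y ⊆ merged ends ω' s X Y := by
  rintro v (hv | ⟨⟨x, hx, hsx⟩, y, hy, hyv⟩)
  · exact Or.inl (conn_mono h hv)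
  · exact Or.inr ⟨⟨x, hx, conn_mono h hsx⟩, y, hy, conn_mono h hyv⟩

/-- If `s` is not connected to `X`, the merged cluster is the plain cluster. -/
lemma merged_eq_cluster_of_not_conn {ω : Config E} {s : V} {X : Set V} (Y : Set V)
    (h : ¬ ∃ x ∈ X, Conn ends ω s x) : merged ends ω s X Y = cluster ends ω s := by
  ext v
  simp only [mem_merged, mem_cluster]
  exact ⟨fun hv => hv.elim id fun hv' => (h hv'.1).elim, Or.inl⟩

/-- If `s` is connected to `X`, the merged cluster contains the cluster of every vertex of `Y`. -/
lemma cluster_subset_merged_of_conn {ω : Config E} {s : V} {X Y : Set V}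
    (h : ∃ x ∈ X, Conn ends ω s x) {y : V} (hy : y ∈ Y) :
    cluster ends ω y ⊆ merged ends ω s X Y :=
  fun _ hv => Or.inr ⟨h, y, hy, hv⟩

/-- **Closed off**: the merged cluster is a union of open clusters — the cluster of any of its
vertices lies inside it. -/
lemma cluster_subset_merged_of_mem {ω : Config E} {s : V} {X Y : Set V} {u : V}
    (hu : u ∈ merged ends ω s X Y) : cluster ends ω u ⊆ merged ends ω s X Y := by
  rcases hu with hu | ⟨hsX, y, hy, hyu⟩
  · exact fun _ hv => Or.inl (conn_trans hu hv)
  · exact fun _ hv => Or.inr ⟨hsX, y, hy, conn_trans hyu hv⟩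

/-- `t ∉ S*` if and only if `s ∉ T*` (both say `s ↮ t` and (`s ↮ X` or `t ↮ Y`)). -/
lemma notMem_merged_iff (ω : Config E) (s t : V) (X Y : Set V) :
    t ∉ merged ends ω s X Y ↔ s ∉ merged ends ω t Y X := by
  simp only [mem_merged, not_or, not_and]
  constructor
  · rintro ⟨hst, h⟩
    refine ⟨fun hts => hst (conn_symm hts), fun htY => ?_⟩
    rintro ⟨x, hx, hxs⟩
    obtain ⟨y, hy, hty⟩ := htY
    exact h ⟨x, hx, conn_symm hxs⟩ ⟨y, hy, conn_symm hty⟩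
  · rintro ⟨hts, h⟩
    refine ⟨fun hst => hts (conn_symm hst), fun hsX => ?_⟩
    rintro ⟨y, hy, hyt⟩
    obtain ⟨x, hx, hsx⟩ := hsX
    exact h ⟨y, hy, conn_symm hyt⟩ ⟨x, hx, conn_symm hsx⟩

end Defs

/-! ## Configurations with the edges touching a set closed -/

section Del

variable {V : Type*} {E : Type*} {ends : E → Sym2 V}

/-- Closing edges gives a smaller configuration. -/
lemma delConfig_le (W : Set V) (ω : Config E) : delConfig ends W ω ≤ ω := by
  intro e
  by_cases he : e ∈ touches ends W
  · rw [delConfig_apply_of_mem he]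
    exact Bool.false_le _
  · rw [delConfig_apply_of_notMem he]

/-- `delConfig` is monotone in the configuration. -/
lemma delConfig_mono_config (W : Set V) {ω ω' : Config E} (h : ω ≤ ω') :
    delConfig ends W ω ≤ delConfig ends W ω' := by
  intro e
  by_cases he : e ∈ touches ends W
  · rw [delConfig_apply_of_mem he, delConfig_apply_of_mem he]
  · rw [delConfig_apply_of_notMem he, delConfig_apply_of_notMem he]
    exact h e

/-- **Spatial Markov property for closed-off sets**: if every cluster meeting `W` lies in `W`
and `v ∉ W`, the connections of `v` do not use the edges touching `W`. -/
lemma conn_delConfig_iff_of_closedOff {ω : Config E} {W : Set V}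
    (hW : ∀ u ∈ W, cluster ends ω u ⊆ W) {v w : V} (hv : v ∉ W) :
    Conn ends (delConfig ends W ω) v w ↔ Conn ends ω v w := by
  constructor
  · exact conn_mono (delConfig_le W ω)
  · intro h
    have key : w ∈ {x | x ∉ W ∧ Conn ends (delConfig ends W ω) v x} := by
      refine mem_of_conn_of_closed (ends := ends) (ω := ω) ?_ ⟨hv, conn_refl _ _ _⟩ h
      rintro x ⟨hxW, hxc⟩ y hxy
      obtain ⟨_, e, he, hends⟩ := openGraph_adj.1 hxy
      have hyW : y ∉ W := by
        intro hy
        exact hxW (hW y hy (conn_of_openAdj (OpenAdj.symm ⟨e, he, hends⟩)))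
      have hnt : e ∉ touches ends W := by
        rintro ⟨x', hx', y', hends'⟩
        rw [hends, Sym2.eq_iff] at hends'
        rcases hends' with ⟨rfl, _⟩ | ⟨_, rfl⟩
        · exact hxW hx'
        · exact hyW hx'
      have he' : delConfig ends W ω e = true := by
        rw [delConfig_apply_of_notMem hnt]; exact he
      exact ⟨hyW, conn_trans hxc (conn_of_openAdj ⟨e, he', hends⟩)⟩
    exact key.2

/-- The cluster of a vertex outside a closed-off set `W` is its cluster in `G ∖ W`. -/
lemma cluster_delConfig_of_closedOff {ω : Config E} {W : Set V}
    (hW : ∀ u ∈ W, cluster ends ω u ⊆ W) {v : V} (hv : v ∉ W) :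
    cluster ends (delConfig ends W ω) v = cluster ends ω v := by
  ext w
  simp only [mem_cluster]
  exact conn_delConfig_iff_of_closedOff hW hv

/-- **Spatial Markov identity for the merged clusters**: on `{t ∉ S*}`, the merged cluster of
`t` (for `(Y, X)`) is its merged cluster in `G ∖ S*`. -/
lemma merged_delConfig_merged {ω : Config E} {s t : V} {X Y : Set V}
    (ht : t ∉ merged ends ω s X Y) :
    merged ends (delConfig ends (merged ends ω s X Y) ω) t Y X = merged ends ω t Y X := by
  set W := merged ends ω s X Y with hWdef
  have hW : ∀ u ∈ W, cluster ends ω u ⊆ W := fun u hu => cluster_subset_merged_of_mem hu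
  have hCt : cluster ends (delConfig ends W ω) t = cluster ends ω t :=
    cluster_delConfig_of_closedOff hW ht
  have hconn : ∀ y, Conn ends (delConfig ends W ω) t y ↔ Conn ends ω t y :=
    fun y => conn_delConfig_iff_of_closedOff hW ht
  ext v
  simp only [mem_merged]
  rw [← mem_cluster, ← mem_cluster, hCt]
  refine or_congr Iff.rfl ?_
  constructor
  · rintro ⟨⟨y, hy, hty⟩, x, hx, hxv⟩
    refine ⟨⟨y, hy, (hconn y).1 hty⟩, x, hx, conn_mono (delConfig_le W ω) hxv⟩
  · rintro ⟨⟨y, hy, hty⟩, x, hx, hxv⟩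
    refine ⟨⟨y, hy, (hconn y).2 hty⟩, x, hx, ?_⟩
    -- `s ↮ X`, for otherwise `t ∈ C_y ⊆ S*`; hence `x ∉ S*` and the cluster of `x` is untouched
    have hsX : ¬ ∃ x' ∈ X, Conn ends ω s x' := by
      rintro hsX
      exact ht (cluster_subset_merged_of_conn hsX hy (conn_symm hty))
    have hxW : x ∉ W := by
      intro hxW
      rcases hxW with hxW | hxW
      · exact hsX ⟨x, hx, hxW⟩
      · exact hsX hxW.1
    exact (conn_delConfig_iff_of_closedOff hW hxW).2 hxv

/-- **Coalescence**: if every edge at `t` is closed and `t ∉ Y`, the merged cluster of `t` is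
`{t}`, whatever the rest of the configuration. -/
lemma merged_eq_singleton_of_allClosed {ω : Config E} {t : V}
    (hω : ∀ e ∈ touches ends {t}, ω e = false) {Y X : Set V} (htY : t ∉ Y) :
    merged ends ω t Y X = {t} := by
  have hCt : cluster ends ω t = {t} := by
    apply Set.Subset.antisymm
    · intro u hu
      refine mem_of_conn_of_closed (ends := ends) (ω := ω) (S := {t}) ?_ rfl hu
      rintro x hx y hxy
      rw [Set.mem_singleton_iff] at hx
      subst hx
      obtain ⟨_, e, he, hends⟩ := openGraph_adj.1 hxy
      have : ω e = false := hω e ⟨x, rfl, y, hends⟩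
      rw [this] at he
      exact absurd he (by decide)
    · intro u hu
      rw [Set.mem_singleton_iff] at hu
      rw [hu]
      exact mem_cluster_self ends ω t
  ext v
  simp only [mem_merged]
  rw [← mem_cluster, hCt]
  constructor
  · rintro (hv | ⟨⟨y, hy, hty⟩, _⟩)
    · exact hv
    · exfalso
      have : y ∈ cluster ends ω t := hty
      rw [hCt] at this
      rw [Set.mem_singleton_iff] at this
      exact htY (this ▸ hy)
  · intro hv
    exact Or.inl hv

/-- Closing the edges touching `W` keeps every edge at `t` closed. -/
lemma allClosed_delConfig {ω : Config E} {t : V} (hω : ∀ e ∈ touches ends {t}, ω e = false)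
    (W : Set V) : ∀ e ∈ touches ends {t}, delConfig ends W ω e = false := by
  intro e he
  by_cases h : e ∈ touches ends W
  · rw [delConfig_apply_of_mem h]
  · rw [delConfig_apply_of_notMem h]
    exact hω e he

end Del

/-! ## The domain Markov property of the merged level sets -/

section Markov

variable {V : Type*} {E : Type*} {ends : E → Sym2 V}

/-- If `ω, ω'` agree on the edges touching `W` and `S*(ω) = W`, then `S*(ω') = W`. -/
lemma merged_eq_of_eqOn_touches {ω ω' : Config E} {s : V} {X Y : Set V} {W : Set V}
    (h : ∀ e ∈ touches ends W, ω e = ω' e) (hW : merged ends ω s X Y = W) :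
    merged ends ω' s X Y = W := by
  have hsub : cluster ends ω s ⊆ W := hW ▸ cluster_subset_merged ω s X Y
  have hCs : cluster ends ω' s = cluster ends ω s :=
    cluster_eq_of_eqOn_touches (fun e he => h e (touches_mono hsub he)) rfl
  have hconn : ∀ v, Conn ends ω' s v ↔ Conn ends ω s v := by
    intro v
    rw [← mem_cluster, ← mem_cluster, hCs]
  by_cases hsX : ∃ x ∈ X, Conn ends ω s x
  · have hsX' : ∃ x ∈ X, Conn ends ω' s x := by
      obtain ⟨x, hx, hsx⟩ := hsX
      exact ⟨x, hx, (hconn x).2 hsx⟩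
    have hCy : ∀ y ∈ Y, cluster ends ω' y = cluster ends ω y := by
      intro y hy
      have hsuby : cluster ends ω y ⊆ W := hW ▸ cluster_subset_merged_of_conn hsX hy
      exact cluster_eq_of_eqOn_touches (fun e he => h e (touches_mono hsuby he)) rfl
    rw [← hW]
    ext v
    simp only [mem_merged]
    rw [hconn v]
    refine or_congr Iff.rfl ?_
    constructor
    · rintro ⟨_, y, hy, hyv⟩
      refine ⟨hsX, y, hy, ?_⟩
      have : v ∈ cluster ends ω' y := hyv
      rw [hCy y hy] at this
      exact this
    · rintro ⟨_, y, hy, hyv⟩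
      refine ⟨hsX', y, hy, ?_⟩
      have : v ∈ cluster ends ω y := hyv
      rw [← hCy y hy] at this
      exact this
  · have hsX' : ¬ ∃ x ∈ X, Conn ends ω' s x := by
      rintro ⟨x, hx, hsx⟩
      exact hsX ⟨x, hx, (hconn x).1 hsx⟩
    rw [merged_eq_cluster_of_not_conn Y hsX', hCs, ← merged_eq_cluster_of_not_conn Y hsX, hW]

/-- **Domain Markov property**: the event `{S* = W}` is determined by the edges touching `W`. -/
theorem dependsOn_mergedEvent (ends : E → Sym2 V) (s : V) (X Y W : Set V) :
    DependsOn (· ∈ {ω : Config E | merged ends ω s X Y = W}) (touches ends W) := by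
  intro ω ω' h
  exact propext ⟨merged_eq_of_eqOn_touches h,
    merged_eq_of_eqOn_touches fun e he => (h e he).symm⟩

end Markov

/-! ## The tower identity: explore `S*`, the rest is fresh -/

section Tower

variable {V : Type*} {E : Type*} [Fintype E] [DecidableEq E] [Fintype V] [DecidableEq V]
  {R : Type*} [CommRing R]

omit [DecidableEq V] in
/-- **Tower identity for the merged pair**: with `S* = merged ω s X Y`, `T* = merged ω t Y X` and
`Q = {t ∉ S*}`, `E[Φ(S*, T*) 1_Q] = E[Φ̂(S*) 1_Q]` where
`Φ̂(W) = E_{ω'}[Φ(W, merged (delConfig W ω') t Y X)]` is the expectation over a fresh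
configuration of `G ∖ W`. -/
theorem expect_merged_mul_indicator (p : E → R) (ends : E → Sym2 V) (s t : V) (X Y : Set V)
    (Φ : Set V → Set V → R) :
    expect p (fun ω => Φ (merged ends ω s X Y) (merged ends ω t Y X) *
        ({ω : Config E | t ∉ merged ends ω s X Y}).indicator 1 ω) =
      expect p (fun ω => expect p (fun ω' => Φ (merged ends ω s X Y)
        (merged ends (delConfig ends (merged ends ω s X Y) ω') t Y X)) *
        ({ω : Config E | t ∉ merged ends ω s X Y}).indicator 1 ω) := by
  classical
  let c : Set V → R := fun W => ({W' : Set V | t ∉ W'}.indicator 1 W)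
  let D : Set V → Config E → R := fun W ω => Φ W (merged ends (delConfig ends W ω) t Y X)
  let Ψ : Set V → Config E → R := fun W ω => c W * D W ω
  have hΨ : ∀ W, DependsOn (Ψ W) (touches ends W)ᶜ := by
    intro W ω ω' h
    simp only [Ψ, D]
    rw [delConfig_congr h]
  have hS : ∀ W : Set V,
      DependsOn (· ∈ {ω : Config E | merged ends ω s X Y = W}) (touches ends W) :=
    fun W => dependsOn_mergedEvent ends s X Y W
  have hdisj : ∀ W : Set V, Disjoint (touches ends W) (touches ends W)ᶜ :=
    fun W => disjoint_compl_right
  have hpt : ∀ ω, Φ (merged ends ω s X Y) (merged ends ω t Y X) *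
      ({ω : Config E | t ∉ merged ends ω s X Y}).indicator (1 : Config E → R) ω =
      Ψ (merged ends ω s X Y) ω := by
    intro ω
    simp only [Ψ, c, D]
    by_cases hst : t ∈ merged ends ω s X Y
    · rw [Set.indicator_of_notMem (show ω ∉ {ω : Config E | t ∉ merged ends ω s X Y} from
          fun h => h hst),
        Set.indicator_of_notMem (show merged ends ω s X Y ∉ {W' : Set V | t ∉ W'} from
          fun h => h hst)]
      simp
    · rw [Set.indicator_of_mem (show ω ∈ {ω : Config E | t ∉ merged ends ω s X Y} from hst),
        Set.indicator_of_mem (show merged ends ω s X Y ∈ {W' : Set V | t ∉ W'} from hst),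
        merged_delConfig_merged hst]
      simp
  have hΨexp : ∀ W, expect p (Ψ W) =
      c W * expect p (fun ω' => Φ W (merged ends (delConfig ends W ω') t Y X)) := by
    intro W
    simp only [Ψ, D]
    rw [expect_const_mul]
  have e1 : (fun ω => Φ (merged ends ω s X Y) (merged ends ω t Y X) *
      ({ω : Config E | t ∉ merged ends ω s X Y}).indicator (1 : Config E → R) ω) =
      fun ω => Ψ (merged ends ω s X Y) ω :=
    funext hpt
  rw [e1, expect_tower p hdisj (S := fun ω => merged ends ω s X Y) hS hΨ]
  simp only [hΨexp]
  unfold expect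
  refine Finset.sum_congr rfl fun ω _ => ?_
  simp only [c]
  by_cases hst : t ∈ merged ends ω s X Y
  · rw [Set.indicator_of_notMem (show merged ends ω s X Y ∉ {W' : Set V | t ∉ W'} from
        fun h => h hst),
      Set.indicator_of_notMem (show ω ∉ {ω : Config E | t ∉ merged ends ω s X Y} from
        fun h => h hst)]
    simp
  · rw [Set.indicator_of_mem (show merged ends ω s X Y ∈ {W' : Set V | t ∉ W'} from hst),
      Set.indicator_of_mem (show ω ∈ {ω : Config E | t ∉ merged ends ω s X Y} from hst)]
    simp

end Tower

end MergedU

end Summit.Ventures.PercRepro2
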